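import Literature.Analysis.FunctionSpaces.KantorovichSobolevInterpolation
import Literature.Analysis.FunctionSpaces.TorusMaximalLipschitz
import Literature.Analysis.FunctionSpaces.TorusRademacher
import HarnessLib

/-!
# The `L¹` translation modulus of a `C¹` function on `T^d`, and positivity of the mollifier constants

Analysis/FunctionSpaces support file (everything proved). Two inputs for applying the
Kantorovich–Sobolev interpolation inequality (Seis 2022, Lemma 4, the tree's
`Torus.krLogDist_ge_of_translation`) to a smooth datum:

* `Torus.eLpNorm_translate_sub_le_integral_norm_gradient` — for `C¹` real `θ` and `y ∈ T^d`,
  `‖θ(· - y) - θ‖_{L¹} ≤ (√d ∫ ‖∇θ‖) ‖y‖` (fundamental theorem of calculus along the segment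
  from `x` to `x - y` lifted to `ℝ^d` — `Torus.sub_eq_integral_fderiv_segment` of
  `TorusPoincareMorrey` —, Fubini, translation invariance; `‖reprc y‖ ≤ √d ‖y‖`);
* `Torus.gradProfileMass_pos`, `Torus.lemma4Const_pos` — the constants `C₁ = ∫ ‖Dρ₁‖` and
  `lemma4Const d` are positive as soon as `d` is nonempty (a compactly supported unit-mass bump is
  not constant).

## References

* C. Seis, Comm. Math. Phys. 2022 (arXiv:2003.08794), Lemma 4. [`Seis2022`]
-/

noncomputable section

open MeasureTheory Set Filter Topology UnitAddTorus Function Metric intervalIntegral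
open scoped ENNReal NNReal

namespace Literature.Analysis.FunctionSpaces

namespace Torus

variable {d : Type*} [Fintype d] [DecidableEq d]

/-! ## The `L¹` translation modulus of a `C¹` function -/

omit [DecidableEq d] in
/-- **The `L¹` translation modulus of a `C¹` function on `T^d`**:
`∫ |θ(x - y) - θ(x)| dx ≤ (√d ∫ ‖∇θ‖) ‖y‖`. [folklore] -/
theorem integral_abs_translate_sub_le {θ : UnitAddTorus d → ℝ} (hθ : IsContDiff 1 θ) (y : UnitAddTorus d) :
    ∫ x, |θ (x - y) - θ x| ≤ (Real.sqrt (Fintype.card d) * ∫ x, ‖Torus.gradient θ x‖) * ‖y‖ := by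
  set w : EuclideanSpace ℝ d := -reprc y with hw
  have hy : ∀ x : UnitAddTorus d, x - y = x + proj w := fun x => by
    rw [hw, proj_neg, proj_reprc, sub_eq_add_neg]
  have hc : Continuous (Torus.fderiv θ) := hθ.continuous_fderiv
  obtain ⟨C, hC⟩ := exists_forall_norm_le_of_continuous hc
  -- pointwise FTC bound
  have hpt : ∀ x, |θ (x - y) - θ x| ≤ ∫ s in (0 : ℝ)..1, ‖Torus.fderiv θ (x + proj (s • w))‖ * ‖w‖ := by
    intro x
    rw [hy x, sub_eq_integral_fderiv_segment hθ x w, ← Real.norm_eq_abs]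
    refine (intervalIntegral.norm_integral_le_integral_norm zero_le_one).trans (integral_mono_on zero_le_one ?_ ?_ fun s _ => ?_)
    · exact ((hc.comp (continuous_const.add (continuous_proj.comp (continuous_id.smul continuous_const)))).clm_apply
        continuous_const).norm.intervalIntegrable _ _
    · exact ((hc.comp (continuous_const.add (continuous_proj.comp (continuous_id.smul continuous_const)))).norm.mul
        continuous_const).intervalIntegrable _ _
    · exact ContinuousLinearMap.le_opNorm _ _
  -- integrate and swap
  have hF : Continuous fun p : UnitAddTorus d × ℝ => ‖Torus.fderiv θ (p.1 + proj (p.2 • w))‖ * ‖w‖ :=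
    ((hc.comp (continuous_fst.add (continuous_proj.comp (continuous_snd.smul continuous_const)))).norm.mul
      continuous_const)
  have hFi : Integrable (uncurry fun (x : UnitAddTorus d) (s : ℝ) => ‖Torus.fderiv θ (x + proj (s • w))‖ * ‖w‖)
      ((volume : Measure (UnitAddTorus d)).prod ((volume : Measure ℝ).restrict (Ioc 0 1))) := by
    refine Integrable.mono' (integrable_const (C * ‖w‖)) hF.aestronglyMeasurable (Eventually.of_forall fun p => ?_)
    simp only [uncurry, Real.norm_eq_abs]
    rw [abs_of_nonneg (mul_nonneg (norm_nonneg _) (norm_nonneg _))]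
    exact mul_le_mul_of_nonneg_right (hC _) (norm_nonneg _)
  calc ∫ x, |θ (x - y) - θ x| ≤ ∫ x, ∫ s in (0 : ℝ)..1, ‖Torus.fderiv θ (x + proj (s • w))‖ * ‖w‖ := by
        refine integral_mono_of_nonneg (Eventually.of_forall fun x => abs_nonneg _) ?_ (Eventually.of_forall hpt)
        simp_rw [integral_of_le zero_le_one]
        exact hFi.integral_prod_left
    _ = ∫ s in Ioc (0 : ℝ) 1, ∫ x, ‖Torus.fderiv θ (x + proj (s • w))‖ * ‖w‖ := by
        simp_rw [integral_of_le zero_le_one]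
        exact integral_integral_swap hFi
    _ = ∫ s in Ioc (0 : ℝ) 1, (∫ x, ‖Torus.fderiv θ x‖) * ‖w‖ := by
        refine integral_congr_ae (Eventually.of_forall fun s => ?_)
        dsimp only
        rw [MeasureTheory.integral_mul_const, integral_add_right_eq_self (fun x => ‖Torus.fderiv θ x‖) (proj (s • w))]
    _ = (∫ x, ‖Torus.fderiv θ x‖) * ‖w‖ := by
        rw [setIntegral_const, measureReal_def, Real.volume_Ioc, sub_zero, ENNReal.toReal_ofReal zero_le_one, one_smul]
    _ ≤ (Real.sqrt (Fintype.card d) * ∫ x, ‖Torus.gradient θ x‖) * ‖y‖ := by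
        have e : ∫ x, ‖Torus.fderiv θ x‖ = ∫ x, ‖Torus.gradient θ x‖ :=
          integral_congr_ae (Eventually.of_forall fun x => (norm_gradient_eq_norm_torusFderiv θ x).symm)
        rw [e, hw, norm_neg]
        have h0 : 0 ≤ ∫ x, ‖Torus.gradient θ x‖ := integral_nonneg fun _ => norm_nonneg _
        calc (∫ x, ‖Torus.gradient θ x‖) * ‖reprc y‖ ≤ (∫ x, ‖Torus.gradient θ x‖) * (Real.sqrt (Fintype.card d) * ‖y‖) :=
              mul_le_mul_of_nonneg_left (norm_reprc_le_sqrt_card_mul_norm y) h0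
          _ = _ := by ring

omit [DecidableEq d] in
/-- The `L¹` translation modulus in `eLpNorm` form, as consumed by `krLogDist_ge_of_translation`:
`‖θ(· - y) - θ‖_{L¹} ≤ ofReal (g ‖y‖)` for any `g ≥ √d ∫ ‖∇θ‖`. [folklore] -/
theorem eLpNorm_translate_sub_le_integral_norm_gradient {θ : UnitAddTorus d → ℝ} (hθ : IsContDiff 1 θ)
    {g : ℝ} (hg : Real.sqrt (Fintype.card d) * ∫ x, ‖Torus.gradient θ x‖ ≤ g) (y : UnitAddTorus d) :
    eLpNorm (fun x => θ (x - y) - θ x) 1 volume ≤ ENNReal.ofReal (g * ‖y‖) := by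
  have hc : Continuous θ := hθ.continuous
  have hi : Integrable (fun x => θ (x - y) - θ x) volume :=
    ((hc.comp (continuous_id.sub continuous_const)).sub hc).integrable_unitAddTorus
  rw [eLpNorm_one_eq_lintegral_enorm, ← ofReal_integral_norm_eq_lintegral_enorm hi]
  refine ENNReal.ofReal_le_ofReal ?_
  simp_rw [Real.norm_eq_abs]
  exact (integral_abs_translate_sub_le hθ y).trans (mul_le_mul_of_nonneg_right hg (norm_nonneg _))

/-! ## Positivity of the mollifier constants -/

omit [DecidableEq d] in
/-- The unit-mass profile is not constant: its gradient has positive total mass when `d` is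
nonempty. [folklore] -/
theorem gradProfileMass_pos [Nonempty d] : 0 < gradProfileMass d := by
  classical
  by_contra hneg
  have h0 : gradProfileMass d = 0 := le_antisymm (le_of_not_gt hneg) gradProfileMass_nonneg
  -- the continuous nonnegative integrand vanishes identically
  have hc : Continuous fun v => ‖_root_.fderiv ℝ (profileOne d) v‖ := continuous_fderiv_profileOne.norm
  have hae : (fun v => ‖_root_.fderiv ℝ (profileOne d) v‖) =ᵐ[volume] 0 :=
    (integral_eq_zero_iff_of_nonneg (fun v => norm_nonneg _) integrable_norm_fderiv_profileOne).1 h0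
  have hzero : ∀ v, _root_.fderiv ℝ (profileOne d) v = 0 := by
    have heq := (hc.ae_eq_iff_eq volume continuous_const).1 hae
    intro v
    have h1 : ‖_root_.fderiv ℝ (profileOne d) v‖ = 0 := congr_fun heq v
    exact norm_eq_zero.1 h1
  -- hence the profile is constant, contradicting compact support and unit mass
  have hconst : ∀ v, profileOne d v = profileOne d 0 := fun v =>
    is_const_of_fderiv_eq_zero (contDiff_profileOne.differentiable (by simp)) hzero v 0
  obtain ⟨i⟩ := ‹Nonempty d›
  set v : EuclideanSpace ℝ d := EuclideanSpace.single i (2 : ℝ) with hv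
  have hvn : ‖v‖ = 2 := by rw [hv, PiLp.norm_single]; norm_num
  have hv0 : profileOne d v = 0 := by
    have : v ∉ support (profileOne d) := by
      rw [support_profileOne, mem_ball_zero_iff, hvn]; norm_num
    simpa [mem_support] using this
  have h00 : profileOne d 0 ≠ 0 := by
    have : (0 : EuclideanSpace ℝ d) ∈ support (profileOne d) := by
      rw [support_profileOne]; exact mem_ball_self zero_lt_one
    exact this
  exact h00 (by rw [← hconst v, hv0])

omit [DecidableEq d] in
/-- `lemma4Const d > 0` for nonempty `d`. [folklore] -/
theorem lemma4Const_pos [Nonempty d] : 0 < lemma4Const d := by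
  have hcard : 0 < (Fintype.card d : ℝ) := by exact_mod_cast Fintype.card_pos
  rw [lemma4Const, lipConst]
  have := gradProfileMass_pos (d := d)
  positivity

end Torus

end Literature.Analysis.FunctionSpaces
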